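import Mathlib
import Summits.Ventures.HodgeRepro2.Tier7.Line3.ConcreteLevelFactor

/-!
# Tier7/Line3/AdicCompletionLocalField — the local field at the level place is Mathlib's
(seat t7-x1, gen 4; a dictionary row of the level-place chain typed on `NumberField`'s own completions)

LINE 3 (t7-plan-3), version (ii). The level-place chain (CongruenceSubgroup p694858 → TorusSupport p695064 →
JointSupport p696095 → LevelTowerTopology p696895 → TorusCompact p697465 → ConcreteLevelFactor p698828) works over
an abstract field `F` with the three DISPLAYED instance hypotheses `[NormedField F] [ProperSpace F] [IsUltrametricDist F]`
— the [W] column's «`E_{v₁}` a local field (`ProperSpace` + `IsUltrametricDist` as instances of the completion)»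
(crit-2 STATUS l. 15720 (c); REPAIR CENSUS v14 §C (h⁗′)). This module INSTANTIATES them: for a number field `K` and a
finite place `v : HeightOneSpectrum (𝓞 K)`, Mathlib's completion `v.adicCompletion K` (a `NormedField` by
`NumberField.instNormedFieldValuedAdicCompletion`, the norm of the rank-one `v`-adic valuation) is

* ultrametric (`isUltrametricDist_adicCompletion`: `‖n‖ ≤ 1` for every natural `n`, from `adicAbv_natCast_le_one`),
* of FINITE residue field (`finite_residueField_adicCompletion`): the residue field of `𝒪[v.adicCompletion K]` is a
  quotient of the finite `𝓞 K ⧸ v.asIdeal` — density of `K` (`denseRange_algebraMap`) puts every local integer `y`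
  within `Valued.v (· − y) < 1` of a global `x ∈ K` with `v(x) ≤ 1`, `exists_primeCompl_mul_eq_of_integer` writes
  `x · d = n` with `d ∉ v`, the inverse of `d` modulo `v` gives `a = n d′ ∈ 𝓞 K` with `v(x − a) = v(x) v(1 − d d′) < 1`,
  and the ultrametric inequality closes (`residue y = residue a`),
* PROPER (`properSpace_adicCompletion`), by Mathlib's criterion
  `Valued.integer.properSpace_iff_completeSpace_and_isDiscreteValuationRing_integer_and_finite_residueField`
  (complete: a completion; `𝒪[·]` a DVR: Mathlib's instance on `v.adicCompletionIntegers K`; residue field finite: above).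

Consequently `concrete_kappaData_b_fields_adicCompletion` restates ConcreteLevelFactor's assembly at
`F := v.adicCompletion K` with the two instance binders GONE — the level-place `b`-fields of `KappaData` on the concrete
model over Mathlib's local field. INSTANTIATION (plan-3 STATUS l. 15760 (1)): the chain's field is `E_{v₁} = E ⊗_{E⁺} E⁺_{v₁}`,
a FIELD because `v₁` is inert in the CM extension `E/E⁺`, so the row is read with `K := E` (the CM field) and `v := w`
(the unique place of `E` above `v₁`) — not with the completion of the base field. NORMALISATION (l. 15760 (2)): Mathlib's
norm on `v.adicCompletion K` is `‖x‖ = toNNReal (absNorm v.asIdeal) (Valued.v x)` (`NumberField.FinitePlace.norm_def`),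
i.e. `‖ϖ‖ = (absNorm v.asIdeal)⁻¹ = q⁻¹` with `q = Nat.card (𝓞 K ⧸ v.asIdeal)` — the NORMALISED absolute value; so with this
`q` the tower `levelTower normAbv _ hq N = {g : ‖g − 1‖ ≤ q⁻¹^(N+1)}` is exactly the principal congruence subgroup of level
`𝔭_v^(N+1)`, and KappaDataFinLocal's `abv ((k−1) i j) ≤ q⁻¹^N` reads the level off the same `q`.
DICTIONARY (in words, unchanged otherwise): `σ` the involution of `E_w` (the continuous extension of the Galois involution
of `E/E⁺` to `E_w`, isometric because `w` is the only place above `v₁`), `f` / `P` the local second basis, `χA = μ_{A,w}`,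
`ψB = μ_{B,w}⁻¹`, `loc γ = (matO γ).map ψ` as a unit, (C) on the stabiliser, the places `≠ v₁` in `bS`.
Nothing here is about (N), (P), the real `X`, or HC_CM; §8(d): NO. Blind lane: Mathlib + the HodgeRepro2 prefix;
no sorry; axioms ⊆ {propext, Classical.choice, Quot.sound}.
-/

namespace Summit.Ventures.HodgeRepro2.Tier7.Line3.AdicCompletionLocalField

open IsDedekindDomain IsDedekindDomain.HeightOneSpectrum NumberField
open scoped Valued NumberField WithZero

variable {K : Type*} [Field K] [NumberField K] (v : HeightOneSpectrum (𝓞 K))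

/-! ## The norm of the completion is ultrametric -/

/-- every natural number has norm `≤ 1` in the `v`-adic completion (the `v`-adic absolute value of `n` is `≤ 1`). -/
theorem norm_natCast_le_one (n : ℕ) : ‖(n : v.adicCompletion K)‖ ≤ 1 := by
  have h : ((n : K) : v.adicCompletion K) = (n : v.adicCompletion K) := by
    rw [← FinitePlace.embedding_apply v (n : K), map_natCast]
  rw [← h, ← FinitePlace.embedding_apply, FinitePlace.norm_embedding]
  exact NumberField.HeightOneSpectrum.adicAbv_natCast_le_one K v n

/-- **the completion at a finite place is ultrametric** (`IsUltrametricDist` for Mathlib's `NormedField` structure on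
`v.adicCompletion K`). -/
theorem isUltrametricDist_adicCompletion : IsUltrametricDist (v.adicCompletion K) :=
  IsUltrametricDist.isUltrametricDist_of_forall_norm_natCast_le_one (norm_natCast_le_one v)

/-! ## The residue field of the completion is finite -/

/-- a global integer lies in the local integers `𝒪[v.adicCompletion K]`. -/
theorem coe_mem_integer (a : 𝓞 K) :
    ((algebraMap (𝓞 K) K a : K) : v.adicCompletion K) ∈ 𝒪[v.adicCompletion K] := by
  rw [Valuation.mem_integer_iff, valuedAdicCompletion_eq_valuation']
  exact valuation_le_one v a

/-- the global integers as local integers. -/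
noncomputable def toInteger : 𝓞 K →+* 𝒪[v.adicCompletion K] where
  toFun a := ⟨FinitePlace.embedding v (algebraMap (𝓞 K) K a),
    by rw [FinitePlace.embedding_apply]; exact coe_mem_integer v a⟩
  map_one' := Subtype.ext (by simp only [map_one, OneMemClass.coe_one])
  map_mul' a b := Subtype.ext (by simp only [map_mul, Subring.coe_mul])
  map_zero' := Subtype.ext (by simp only [map_zero, ZeroMemClass.coe_zero])
  map_add' a b := Subtype.ext (by simp only [map_add, Subring.coe_add])

/-- `toInteger` composed with the residue map. -/
noncomputable def toResidue : 𝓞 K →+* 𝓀[v.adicCompletion K] :=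
  (IsLocalRing.residue 𝒪[v.adicCompletion K]).comp (toInteger v)

/-- membership in the maximal ideal of the local integers is `Valued.v < 1`. -/
theorem mem_maximalIdeal_iff (x : 𝒪[v.adicCompletion K]) :
    x ∈ 𝓂[v.adicCompletion K] ↔ Valued.v (x : v.adicCompletion K) < 1 := by
  rw [IsLocalRing.mem_maximalIdeal, mem_nonunits_iff]
  exact Valuation.Integer.not_isUnit_iff_valuation_lt_one

/-- an element of `v.asIdeal` has residue `0`. -/
theorem toResidue_eq_zero_of_mem {a : 𝓞 K} (ha : a ∈ v.asIdeal) : toResidue v a = 0 := by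
  simp only [toResidue, RingHom.comp_apply]
  rw [IsLocalRing.residue_eq_zero_iff, mem_maximalIdeal_iff]
  change Valued.v (FinitePlace.embedding v (algebraMap (𝓞 K) K a)) < 1
  rw [FinitePlace.embedding_apply, valuedAdicCompletion_eq_valuation']
  exact (valuation_lt_one_iff_mem v a).2 ha

/-- the induced map from the finite residue field of `𝓞 K` at `v`. -/
noncomputable def quotToResidue : 𝓞 K ⧸ v.asIdeal →+* 𝓀[v.adicCompletion K] :=
  Ideal.Quotient.lift v.asIdeal (toResidue v) fun _ ha => toResidue_eq_zero_of_mem v ha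

/-- every element of `K` that is a local integer at `v` is within `v(·) < 1` of a global integer. -/
theorem exists_integer_valuation_sub_lt_one {x : K} (hx : v.valuation K x ≤ 1) :
    ∃ a : 𝓞 K, v.valuation K (x - algebraMap (𝓞 K) K a) < 1 := by
  obtain ⟨n, d, hnd⟩ := exists_primeCompl_mul_eq_of_integer v x hx
  have hd : Ideal.Quotient.mk v.asIdeal (d : 𝓞 K) ≠ 0 := by
    rw [Ne, Ideal.Quotient.eq_zero_iff_mem]
    exact d.2
  obtain ⟨e, he⟩ := Ideal.Quotient.exists_inv hd
  obtain ⟨d', rfl⟩ := Ideal.Quotient.mk_surjective e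
  have hdd' : (d : 𝓞 K) * d' - 1 ∈ v.asIdeal := by
    rw [← Ideal.Quotient.eq_zero_iff_mem, map_sub, map_mul, he, map_one, sub_self]
  refine ⟨n * d', ?_⟩
  have hx' : x - algebraMap (𝓞 K) K (n * d') = x * (1 - algebraMap (𝓞 K) K ((d : 𝓞 K) * d')) := by
    rw [map_mul, map_mul, ← hnd]
    ring
  rw [hx', Valuation.map_mul]
  have h1 : v.valuation K (1 - algebraMap (𝓞 K) K ((d : 𝓞 K) * d')) < 1 := by
    have : (1 : K) - algebraMap (𝓞 K) K ((d : 𝓞 K) * d') =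
        algebraMap (𝓞 K) K (-((d : 𝓞 K) * d' - 1)) := by
      rw [map_neg, map_sub, map_one, neg_sub]
    rw [this]
    exact (valuation_lt_one_iff_mem v _).2 (neg_mem hdd')
  calc v.valuation K x * v.valuation K (1 - algebraMap (𝓞 K) K ((d : 𝓞 K) * d'))
      ≤ 1 * v.valuation K (1 - algebraMap (𝓞 K) K ((d : 𝓞 K) * d')) := by gcongr
    _ = v.valuation K (1 - algebraMap (𝓞 K) K ((d : 𝓞 K) * d')) := one_mul _
    _ < 1 := h1

/-- `quotToResidue` is surjective: every local integer is congruent modulo the maximal ideal to a global integer. -/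
theorem quotToResidue_surjective : Function.Surjective (quotToResidue v) := by
  haveI := isUltrametricDist_adicCompletion v
  intro z
  obtain ⟨y, rfl⟩ := IsLocalRing.residue_surjective z
  -- approximate `y` by an element of `K` within norm `< 1`
  have hdense : (y : v.adicCompletion K) ∈ closure (Set.range (algebraMap K (v.adicCompletion K))) := by
    rw [(denseRange_algebraMap K v).closure_range]; exact Set.mem_univ _
  obtain ⟨x', ⟨x, rfl⟩, hxy⟩ := Metric.mem_closure_iff.1 hdense 1 one_pos
  rw [dist_eq_norm, Valued.toNormedField.norm_lt_one_iff] at hxy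
  have hxe : algebraMap K (v.adicCompletion K) x = FinitePlace.embedding v x := rfl
  rw [hxe] at hxy
  have hyv : Valued.v (y : v.adicCompletion K) ≤ 1 := y.2
  have hsub : Valued.v (FinitePlace.embedding v x - (y : v.adicCompletion K)) < 1 := by
    rw [Valuation.map_sub_swap]; exact hxy
  -- `x` is a local integer at `v`
  have hx : v.valuation K x ≤ 1 := by
    rw [← valuedAdicCompletion_eq_valuation', ← FinitePlace.embedding_apply]
    calc Valued.v (FinitePlace.embedding v x)
        = Valued.v ((FinitePlace.embedding v x - (y : v.adicCompletion K)) + (y : v.adicCompletion K)) := by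
          rw [sub_add_cancel]
      _ ≤ max (Valued.v (FinitePlace.embedding v x - (y : v.adicCompletion K)))
            (Valued.v (y : v.adicCompletion K)) := Valuation.map_add _ _ _
      _ ≤ 1 := max_le hsub.le hyv
  obtain ⟨a, ha⟩ := exists_integer_valuation_sub_lt_one v hx
  refine ⟨Ideal.Quotient.mk _ a, ?_⟩
  simp only [quotToResidue, Ideal.Quotient.lift_mk, toResidue, RingHom.comp_apply]
  rw [← sub_eq_zero, ← map_sub, IsLocalRing.residue_eq_zero_iff, mem_maximalIdeal_iff]
  change Valued.v (FinitePlace.embedding v (algebraMap (𝓞 K) K a) - (y : v.adicCompletion K)) < 1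
  have hav : Valued.v (FinitePlace.embedding v (algebraMap (𝓞 K) K a) - FinitePlace.embedding v x) < 1 := by
    rw [← map_sub, FinitePlace.embedding_apply, valuedAdicCompletion_eq_valuation', Valuation.map_sub_swap]
    exact ha
  calc Valued.v (FinitePlace.embedding v (algebraMap (𝓞 K) K a) - (y : v.adicCompletion K))
      = Valued.v ((FinitePlace.embedding v (algebraMap (𝓞 K) K a) - FinitePlace.embedding v x)
          + (FinitePlace.embedding v x - (y : v.adicCompletion K))) := by rw [sub_add_sub_cancel]
    _ ≤ max _ _ := Valuation.map_add _ _ _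
    _ < 1 := max_lt hav hsub

/-- **the residue field of the completion at a finite place is finite.** -/
theorem finite_residueField_adicCompletion : Finite 𝓀[v.adicCompletion K] :=
  Finite.of_surjective _ (quotToResidue_surjective v)

/-! ## The completion is a proper (locally compact) field -/

/-- the local integers form a discrete valuation ring (Mathlib's instance on `v.adicCompletionIntegers K`,
read on `𝒪[v.adicCompletion K]`). -/
theorem isDiscreteValuationRing_integer : IsDiscreteValuationRing 𝒪[v.adicCompletion K] :=
  inferInstanceAs (IsDiscreteValuationRing (v.adicCompletionIntegers K))

/-- **the completion at a finite place is a proper metric space** (locally compact). -/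
theorem properSpace_adicCompletion : ProperSpace (v.adicCompletion K) := by
  haveI := isDiscreteValuationRing_integer v
  haveI := finite_residueField_adicCompletion v
  exact (Valued.integer.properSpace_iff_completeSpace_and_isDiscreteValuationRing_integer_and_finite_residueField
    (K := v.adicCompletion K) (Γ₀ := ℤᵐ⁰)).2 ⟨inferInstance, inferInstance, inferInstance⟩

/-- the ultrametric structure of the completion, as an instance. -/
instance instIsUltrametricDist : IsUltrametricDist (v.adicCompletion K) :=
  isUltrametricDist_adicCompletion v

/-- the properness of the completion, as an instance. -/
instance instProperSpace : ProperSpace (v.adicCompletion K) :=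
  properSpace_adicCompletion v

/-! ## The level-place assembly over Mathlib's local field -/

open Matrix MeasureTheory
  Summit.Ventures.HodgeRepro2.Tier7.Line3.CongruenceSubgroup
  Summit.Ventures.HodgeRepro2.Tier7.Line3.TorusSupport
  Summit.Ventures.HodgeRepro2.Tier7.Line3.LevelTowerTopology
  Summit.Ventures.HodgeRepro2.Tier7.Line3.LevelFactor

/-- **ConcreteLevelFactor's assembly at `F := v.adicCompletion K`**: the statement of
`ConcreteLevelFactor.concrete_kappaData_b_fields` (p698828) over Mathlib's completion of the number field `K` at the
finite place `v`, with the instance binders `[ProperSpace F] [IsUltrametricDist F]` DISCHARGED by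
`properSpace_adicCompletion` / `isUltrametricDist_adicCompletion` — only the data-level facts remain displayed:
the continuous isometric involution `σ`, the second basis `f` with its matrix `P`, the second torus inside the integral
matrices (`hB`, `hB'`), the unitary locally constant characters, the representative `loc`, the dominant coset `γ₀`,
the central match on its stabiliser, and the `N`-independent part `bS` with its three clauses. -/
theorem concrete_kappaData_b_fields_adicCompletion (σ : v.adicCompletion K →+* v.adicCompletion K)
    (hσc : Continuous σ) (hσn : ∀ x, ‖σ x‖ = ‖x‖)
    (f : Fin 2 → Fin 2 → v.adicCompletion K) (P : GL (Fin 2) (v.adicCompletion K))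
    (hP : ∀ j, (P : Matrix (Fin 2) (Fin 2) (v.adicCompletion K)).col j = f j)
    {q : ℝ} (hq : 1 < q)
    (hB : ∀ b : torusB σ f, EntryLE normAbv 1
      ((iotaB σ f b : GL (Fin 2) (v.adicCompletion K)) : Matrix (Fin 2) (Fin 2) (v.adicCompletion K)))
    (hB' : ∀ b : torusB σ f, EntryLE normAbv 1
      (((iotaB σ f b)⁻¹ : GL (Fin 2) (v.adicCompletion K)) : Matrix (Fin 2) (Fin 2) (v.adicCompletion K)))
    {Orb : Type*} (χA : torusA σ →* ℂ) (ψB : torusB σ f →* ℂ) (hχA : ∀ a, ‖χA a‖ = 1)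
    (hψB : ∀ b, ‖ψB b‖ = 1) (hχA' : IsLocallyConstant (χA : torusA σ → ℂ))
    (hψB' : IsLocallyConstant (ψB : torusB σ f → ℂ)) (loc : Orb → GL (Fin 2) (v.adicCompletion K)) (γ₀ : Orb)
    (hmatch : ∀ a b, (iotaA σ a)⁻¹ * loc γ₀ * iotaB σ f b = loc γ₀ → χA a * ψB b = 1)
    (arithS : Orb → Prop) (bS : Orb → ℂ) (bS_support : ∀ γ, bS γ ≠ 0 → arithS γ) (C : ℝ) (size : Orb → ℝ)
    (ε : ℝ) (bS_bound : ∀ γ, arithS γ → ‖bS γ‖ ≤ C * (1 + size γ) ^ ε * ‖bS γ₀‖) (bS_γ₀ : bS γ₀ ≠ 0) :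
    ∃ (mA : MeasurableSpace (torusA σ)) (mB : MeasurableSpace (torusB σ f))
      (μA : Measure (torusA σ)) (μB : Measure (torusB σ f))
      (D : LevelFactorData (torusA σ) (torusB σ f) (GL (Fin 2) (v.adicCompletion K)) Orb μA μB),
      (@BorelSpace (torusA σ) _ mA) ∧ (@BorelSpace (torusB σ f) _ mB) ∧
      μA.IsHaarMeasure ∧ μB.IsHaarMeasure ∧
      D.ιA = iotaA σ ∧ D.ιB = iotaB σ f ∧ D.K = levelTower normAbv isNonarchimedean_normAbv hq ∧
      D.loc = loc ∧ D.γ₀ = γ₀ ∧ D.arithS = arithS ∧ D.bS = bS ∧ D.size = size ∧ D.ε = ε ∧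
      (∀ N γ, D.b N γ ≠ 0 → D.arith N γ) ∧
      (∃ Bb : ℝ, ∀ N γ, D.arith N γ → ‖D.b N γ‖ ≤ Bb * (1 + D.size γ) ^ D.ε * ‖D.b N D.γ₀‖) ∧
      (∃ N₀ : ℕ, ∀ N ≥ N₀, D.b N D.γ₀ ≠ 0) :=
  ConcreteLevelFactor.concrete_kappaData_b_fields σ hσc hσn f P hP hq hB hB' χA ψB hχA hψB hχA' hψB' loc γ₀
    hmatch arithS bS bS_support C size ε bS_bound bS_γ₀

end Summit.Ventures.HodgeRepro2.Tier7.Line3.AdicCompletionLocalField
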